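import Mathlib
import HarnessLib
import Literature.Analysis.OperatorTheory.SchurComplementPolynomialBound
import Literature.Analysis.ValidatedNumerics.ChebyshevInversePolynomial

/-!
# Polynomially filtered Schur-complement inertia certificate for a pencil `K − ρ G` with diagonal `G`

`Literature.Analysis.OperatorTheory.fromBlocks_dotProduct_nonneg_of_schur_poly_cert` is stated for the
standard inner product (`c•1 ⪯ A ⪯ cmax•1`). When the quadratic form is written in an ORTHOGONAL BUT NOT
NORMALISED basis (e.g. orbit sums of a permutation group acting on a canonical basis, Gram matrix
`G = diagonal g`, `g_a = |orbit_a| ∈ ℕ`), normalising would introduce the irrational numbers `√g_a` into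
otherwise integer / rational data. This file gives the same certificate for the PENCIL: hypotheses
`c G_C ⪯ A ⪯ cmax G_C` on the free block (`G_C = diagonal g`, `g > 0`), `1/x ≤ p(x)` on `[c, cmax]`, and ONE
verified positive semidefiniteness of the explicit RATIONAL matrix
`D − Bᵀ · p(G_C⁻¹ A) G_C⁻¹ · B + Σ_j t_j q_j q_jᵀ`; conclusion: the block form `[[A, B], [Bᵀ, D]]` is nonnegative on
`{(x, y) : q_j ⬝ y = 0 ∀ j}`. Proof: congruence by `S = diagonal (1/√g)` (`S G_C S = 1`,
`S · p(S A S) · S = p(S² A) S² = p(G_C⁻¹ A) G_C⁻¹`) reduces it to the standard-metric theorem — the square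
roots live only inside the proof (Sylvester's law of inertia / congruence invariance of positive
semidefiniteness, Horn–Johnson (2013) Thm 4.5.8; Haynsworth (1968)). With
`Literature.Analysis.ValidatedNumerics.chebInvPoly` the analytic side condition disappears
(`fromBlocks_dotProduct_nonneg_of_pencil_chebyshev_cert`).

Pure finite-dimensional real linear algebra; every hypothesis explicit; no `sorry`.
-/

namespace Literature.Analysis.OperatorTheory

open Matrix Polynomial
open scoped Matrix

variable {m n : Type*} [Fintype m] [Fintype n] [DecidableEq m]

/-- `S (S A S)^i S = (S S A)^i (S S)`. [folklore] -/
private theorem conj_pow_eq (S A : Matrix m m ℝ) :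
    ∀ i : ℕ, S * (S * A * S) ^ i * S = (S * S * A) ^ i * (S * S)
  | 0 => by simp
  | (i + 1) => by
      rw [pow_succ', pow_succ',
        show S * (S * A * S * (S * A * S) ^ i) * S = (S * S * A) * (S * (S * A * S) ^ i * S) by
          simp only [Matrix.mul_assoc],
        conj_pow_eq S A i]
      simp only [Matrix.mul_assoc]

/-- `S · p(S A S) · S = p(S² A) · S²` for any square `S` (applied with `S = G^{-1/2}` diagonal).
[folklore] -/
private theorem conj_aeval_conj_eq (S A : Matrix m m ℝ) (p : ℝ[X]) :
    S * aeval (S * A * S) p * S = aeval (S * S * A) p * (S * S) := by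
  refine p.induction_on' (fun p₁ p₂ h₁ h₂ => ?_) (fun i a => ?_)
  · simp only [map_add, Matrix.mul_add, Matrix.add_mul, h₁, h₂]
  · simp only [aeval_monomial, Algebra.algebraMap_eq_smul_one, smul_mul_assoc, one_mul,
      Matrix.mul_smul]
    rw [conj_pow_eq]

/-- **Pencil form of the polynomially filtered inertia certificate (counting form).** Let
`[[A, B], [Bᵀ, D]]` be a real symmetric block matrix (the pencil `K − ρ G` already formed), `g : m → ℝ`
positive weights on the free block with `c · diagonal g ⪯ A ⪯ cmax · diagonal g`, `0 < c`, `p` a real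
polynomial with `1/x ≤ p(x)` on `[c, cmax]`, and suppose the explicit matrix
`D − Bᵀ p(G⁻¹A) G⁻¹ B + Σ_j t_j q_j q_jᵀ` (`G⁻¹ = diagonal (1/g)`; rational in rational data) is positive
semidefinite. Then the block quadratic form is nonnegative on `{(x, y) : q_j ⬝ y = 0 ∀ j}` (codimension
`≤ k`: at most `k` negative eigenvalues, Courant–Fischer). Congruence by `diagonal (1/√g)` into
`fromBlocks_dotProduct_nonneg_of_schur_poly_cert`. [cite: Haynsworth1968, Thm 1]
[cite: HornJohnson2013, Thm 4.5.8] -/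
theorem fromBlocks_dotProduct_nonneg_of_pencil_schur_poly_cert {k : ℕ} (A : Matrix m m ℝ)
    (B : Matrix m n ℝ) (D : Matrix n n ℝ) (g : m → ℝ) (c cmax : ℝ) (p : ℝ[X]) (t : Fin k → ℝ)
    (q : Fin k → n → ℝ) (hg : ∀ i, 0 < g i) (hc : 0 < c)
    (hAc : (A - c • diagonal g).PosSemidef)
    (hAcmax : (cmax • diagonal g - A).PosSemidef)
    (hp : ∀ x ∈ Set.Icc c cmax, 1 / x ≤ p.eval x)
    (hcert : (D - Bᵀ * (aeval (diagonal (fun i => (g i)⁻¹) * A) p * diagonal (fun i => (g i)⁻¹)) * B +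
      ∑ j, t j • vecMulVec (q j) (q j)).PosSemidef)
    (x : m → ℝ) (y : n → ℝ) (hy : ∀ j, q j ⬝ᵥ y = 0) :
    0 ≤ (Sum.elim x y) ⬝ᵥ (fromBlocks A B Bᵀ D *ᵥ (Sum.elim x y)) := by
  -- the congruence `S = G^{-1/2}`
  set s : m → ℝ := fun i => (Real.sqrt (g i))⁻¹ with hs
  set S : Matrix m m ℝ := diagonal s with hS
  have hsq : ∀ i, 0 < Real.sqrt (g i) := fun i => Real.sqrt_pos.mpr (hg i)
  have hss : ∀ i, s i * s i = (g i)⁻¹ := fun i => by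
    rw [hs, ← mul_inv, Real.mul_self_sqrt (hg i).le]
  have hSS : S * S = diagonal (fun i => (g i)⁻¹) := by
    rw [hS, diagonal_mul_diagonal]
    exact congrArg diagonal (funext hss)
  have hSGS : S * diagonal g * S = 1 := by
    rw [hS, diagonal_mul_diagonal, diagonal_mul_diagonal, ← diagonal_one]
    refine congrArg diagonal (funext fun i => ?_)
    have : s i * g i * s i = (s i * s i) * g i := by ring
    rw [this, hss, inv_mul_cancel₀ (hg i).ne']
  have hST : Sᴴ = S := by
    rw [hS, diagonal_conjTranspose]
    simp
  have hSt : Sᵀ = S := by rw [hS, diagonal_transpose]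
  -- transferred hypotheses
  have hAc' : (S * A * S - c • (1 : Matrix m m ℝ)).PosSemidef := by
    have h := hAc.mul_mul_conjTranspose_same S
    rw [hST, Matrix.mul_sub, Matrix.sub_mul, Matrix.mul_smul, Matrix.smul_mul, hSGS] at h
    exact h
  have hAcmax' : (cmax • (1 : Matrix m m ℝ) - S * A * S).PosSemidef := by
    have h := hAcmax.mul_mul_conjTranspose_same S
    rw [hST, Matrix.mul_sub, Matrix.sub_mul, Matrix.mul_smul, Matrix.smul_mul, hSGS] at h
    exact h
  have hcert' : (D - (S * B)ᵀ * (aeval (S * A * S) p) * (S * B) +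
      ∑ j, t j • vecMulVec (q j) (q j)).PosSemidef := by
    have hx : (S * B)ᵀ * (aeval (S * A * S) p) * (S * B) =
        Bᵀ * (aeval (diagonal (fun i => (g i)⁻¹) * A) p * diagonal (fun i => (g i)⁻¹)) * B := by
      rw [transpose_mul, hSt, ← hSS, ← conj_aeval_conj_eq S A p]
      simp only [Matrix.mul_assoc]
    rw [hx]
    exact hcert
  -- the standard-metric certificate on the congruent block matrix, at `x' = G^{1/2} x`
  set x' : m → ℝ := fun i => Real.sqrt (g i) * x i with hx'
  have hSx' : S *ᵥ x' = x := by
    funext i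
    rw [hS, mulVec_diagonal, hx', hs]
    simp only
    rw [← mul_assoc, inv_mul_cancel₀ (hsq i).ne', one_mul]
  have h0 := fromBlocks_dotProduct_nonneg_of_schur_poly_cert (S * A * S) (S * B) D c cmax p t q hc
    hAc' hAcmax' hp hcert' x' y hy
  -- the two forms agree
  have hsym : ∀ v : m → ℝ, x' ⬝ᵥ (S *ᵥ v) = x ⬝ᵥ v := fun v => by
    rw [dotProduct_mulVec, ← mulVec_transpose, hSt, hSx']
  have hform : (Sum.elim x' y) ⬝ᵥ (fromBlocks (S * A * S) (S * B) (S * B)ᵀ D *ᵥ (Sum.elim x' y)) =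
      (Sum.elim x y) ⬝ᵥ (fromBlocks A B Bᵀ D *ᵥ (Sum.elim x y)) := by
    rw [fromBlocks_mulVec, fromBlocks_mulVec, Sum.elim_comp_inl, Sum.elim_comp_inr, Sum.elim_comp_inl,
      Sum.elim_comp_inr, sumElim_dotProduct_sumElim, sumElim_dotProduct_sumElim, transpose_mul, hSt,
      dotProduct_add, dotProduct_add, dotProduct_add, dotProduct_add]
    rw [← mulVec_mulVec, ← mulVec_mulVec, hSx', hsym, ← mulVec_mulVec, hsym, ← mulVec_mulVec, hSx']
  rw [← hform]
  exact h0

/-- **Pencil Chebyshev certificate (no analytic side condition).** The pencil certificate with the explicit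
Chebyshev inverse polynomial `p = chebInvPoly c cmax N` (`0 < c < cmax`, `N ≥ 1`): the verifier's inputs are
the rational data `(A, B, D, g, c, cmax, N, t, q)`, two diagonal-dominance / enclosure checks for
`c G ⪯ A ⪯ cmax G`, and one exact `LDLᵀ` of `D − Bᵀ p(G⁻¹A) G⁻¹ B + Σ t_j q_j q_jᵀ`.
[cite: Haynsworth1968, Thm 1] [cite: GolubVanLoan2013, §11.2.8] -/
theorem fromBlocks_dotProduct_nonneg_of_pencil_chebyshev_cert {k : ℕ} (A : Matrix m m ℝ)
    (B : Matrix m n ℝ) (D : Matrix n n ℝ) (g : m → ℝ) {c cmax : ℝ} {N : ℕ} (t : Fin k → ℝ)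
    (q : Fin k → n → ℝ) (hg : ∀ i, 0 < g i) (hc : 0 < c) (hcm : c < cmax) (hN : N ≠ 0)
    (hAc : (A - c • diagonal g).PosSemidef)
    (hAcmax : (cmax • diagonal g - A).PosSemidef)
    (hcert : (D - Bᵀ * (aeval (diagonal (fun i => (g i)⁻¹) * A)
        (Literature.Analysis.ValidatedNumerics.chebInvPoly c cmax N) * diagonal (fun i => (g i)⁻¹)) * B +
      ∑ j, t j • vecMulVec (q j) (q j)).PosSemidef)
    (x : m → ℝ) (y : n → ℝ) (hy : ∀ j, q j ⬝ᵥ y = 0) :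
    0 ≤ (Sum.elim x y) ⬝ᵥ (fromBlocks A B Bᵀ D *ᵥ (Sum.elim x y)) :=
  fromBlocks_dotProduct_nonneg_of_pencil_schur_poly_cert A B D g c cmax _ t q hg hc hAc hAcmax
    (Literature.Analysis.ValidatedNumerics.one_div_le_eval_chebInvPoly hc hcm hN) hcert x y hy

end Literature.Analysis.OperatorTheory
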